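import Summits.ABC.IUTFork.Joshi.ATS4DescentSpineAbcThetaDivision
import Literature.IUT.LogVolume.GenuineSupportPrimesBound
import Literature.IUT.LogVolume.DistinguishedPrimesBoundTower
import HarnessLib

/-!
# [J-IV] (arXiv:2403.10430v2) §6.8 (6.8.11) AT THE GENUINE THETA TOWER of the E5 spine — DERIVED; and the
# content of the glue `MainBoundGlue` / the printed shape of Prop. 6.10.9 on E-t31's carrier (R-J census rows Y-21f / Y-21a / Y-21d)

Proof-only companion (0 defs) of the abc-iut cell, sub-cell R-J «JOSHI Y-DISCHARGE CENSUS» (rung LADDER-ABC:A2.RESCUE.J; table of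
record `HOME/plan/E/R-J/Y-CENSUS.tsv`, row Y-21 = «[J-IV] λ-line hypotheses of the E5 spine», letters a `MainBoundGlue`, d `Prop6109`,
f `Eq6811`), seat abc-iut-E-t33 (gen 5; lineage = the [J-IV] §7 consumer `thm721_of_thm611OnLambdaLine` / `abc_of_thm721`, p430503 …
p440771). Parents BUILT, every input BY NAME: E-t31's carrier `LocusVolumeDatum` with its reading predicates `Eq6811`, `Prop6109`
(`Joshi/ATS4LocusUpperBounds.lean`, p430311) and glue `MainBoundGlue` (`Joshi/ATS4DescentToFirstMainBound.lean`), E-t30's genuine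
Thm-6.1.1 carrier `MainBoundDatum.ofGenuine` and `MainBoundDatum.thetaTower_logDiffCond_eq` (`Joshi/ATS4DescentSpineAbcTheta.lean`,
p443293), the tree's [IUTchIV] Step (iii) machinery for REAL number fields (abc-iut-L5-t15 `sum_log_distinguished_le_tower`,
`ramified_place_descends_of_not_dvd`; abc-iut-S-d1 / S2 `Cor22.ramificationIdx_divisionTower_eq_one`,
`Cor22.ramificationIdx_thetaField_eq_one`, `Cor22.isGalois_adjoin_jInv`, `Cor22.mem_badPlacesAvoid_of_finBelow_eq`).

SOURCE: K. Joshi, *Construction of Arithmetic Teichmüller Spaces IV*, arXiv:2403.10430v2 (unrefereed; bib `Joshi2024ATS4`):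
(6.8.11)–(6.8.12) p.64 l.2–13 «log(s_ℚ) ≤ 2·d_mod·(log(d_{L_tpd}) + log(f_{L_tpd})) + log(2·3·5·ℓ). This is proved as follows.
Consider the divisor log(s_ℚ), by definition this is simply log(s_ℚ) = Σ_{p ∈ V^dst_ℚ} 1·log(p)»; Lemma 6.7.1 p.61 l.24–30 «the
following conditions are equivalent (1) v_ℚ ∈ V^dst_ℚ. (2) v_ℚ ramifies in L′. (3) v_ℚ divides 30·ℓ or …»; §4.1.2 (8) p.38 l.9
«L_mod ⊆ L_tpd»; Prop. 6.10.9 p.69 l.1–28; page/line = the cell's render `HOME/lit/renders/Joshi-arxiv-2403.10430/`. [IUTchIV] Thm.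
1.10 proof Step (iii) p.25–26 «log(𝔰^ℚ) ≤ 2·d_mod·(log(𝔡^{F_tpd}) + log(𝔣^{F_tpd})) + log(2·3·5·l)», (D0) p.24 (kurims pages).

FRAMING (binding): a third party's unrefereed text TYPED over our interface; NO side is taken on [IUTchIII] Cor. 3.12 / [IUTchIV]
Thm. 1.10, on Joshi's claims, or on Mochizuki's report on them; NOT an abc claim; typed ≠ proved ≠ endorsed. What is PROVED here is
classical algebraic number theory about torsion fields of the Legendre curve (kernel-checked by us) and real-number bookkeeping.

WHAT IS HERE (all PROVED; theorems only; standard axioms; no `sorry`, instance, notation, `def` or new `Prop` fact).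
1. **Y-21a — the CONTENT of `MainBoundGlue` on E-t31's side** (`LocusVolumeDatum.exists_mainBoundGlue_iff`): a carrier `dd` is glued to
   SOME Thm-6.1.1 datum iff `dd.l` is prime, `η_prm = 60`, `e*_mod = 2¹²·3³·5·e` for some `1 ≤ e ≤ d_mod`, `0 ≤ log(d_{L′})` and
   `0 < log(q)`; and every `M : MainBoundDatum` has a glued carrier (`MainBoundDatum.exists_mainBoundGlue`). DEFINITIONAL: the glue
   is eight equalities of reals/naturals (§4.1.1–4.1.2, Prop. 6.2.1); no FACT row enters. (Its joint content WITH the nine inputs is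
   E-t35's calibration p446138 / E-t21's irredundant core p451846 — cited, not restated.)
2. **Y-21f — (6.8.11) DERIVED at the genuine theta tower of the E5 spine.** For `λ ∈ U_X` minimally presented (`P ∈ GenEll.UP`), `ℓ`
   prime, a theta field `F` of `λ` (`Cor22.IsThetaField`, Joshi's `L`), `K ⊇ F` Galois with an `F`-embedding `ψ : K → F̄` inside the
   `ℓ`-division field (`ker ρ̄_{E_F,ℓ} ≤ Gal(F̄/ψK)`, Joshi's `L′`; p447878's binders VERBATIM):
   * `thetaTower_ramified_descends` — Lemma 6.7.1 (2) ⟹ (3) in the tree's (D0) ⟹ (D5) shape: a prime of `K` ramified over `ℚ` with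
     residue characteristic `∤ 2·3·5·ℓ` lies over a place of `F_tpd` that is bad away from `{2, ℓ}` (`Supp(q_{L_tpd})`) or ramified over
     `ℚ` (`Supp(d_{L_tpd})`) — from the tree's Prop. 1.8 (vi)(vii) instance forms for THIS tower.
   * `sum_log_vdst_le_thetaTower` — for every finite set `V` of primes each of which divides `2·3·5·ℓ` or RAMIFIES IN `K` (Lemma 6.7.1
     (1)⟺(2): Joshi's `V^dst_ℚ`; (6.8.12): `log(s_ℚ) = Σ_{p ∈ V^dst_ℚ} log p`):
     `Σ_{p ∈ V} log p ≤ 2·[ℚ(j(λ)):ℚ]·(log-diff(λ) + log f^{∤{2,ℓ}}(λ)) + log(2·3·5·ℓ)` — with `d_mod = [F_mod : ℚ]`, `F_mod = ℚ(j(λ))`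
     the field of moduli (Joshi's `L_mod`, §4.1.1 (2)), `log(d_{L_tpd}) = log-diff(λ)`, `log(f_{L_tpd}) = log f^{∤{2,ℓ}}(λ)` (E-t30's
     dictionary `thetaTower_logDiffCond_eq`).
   * `LocusVolumeDatum.eq6811_of_thetaTowerGlue` — hence **`dd.Eq6811` for EVERY carrier `dd` glued (`MainBoundGlue`) to
     `MainBoundDatum.ofGenuine L_mod … (ofNFPoint λ {2,ℓ}) (ofNFPointOver λ {2,ℓ} F) (ofNFPointOver λ {2,ℓ} K)` whose `V^dst_ℚ` slot
     consists of primes dividing `2·3·5·ℓ` or ramified in `K` and whose `log(s_ℚ)` slot IS `Σ_{p ∈ V^dst_ℚ} log p`**, for every supplier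
     field `L_mod` with `[L_mod : ℚ] ≥ [ℚ(j(λ)) : ℚ]` (equality for Joshi's own `L_mod` = the field of moduli; the E5 spine's consumer
     only reads `d_mod ≤ d`). R-J reading: letter f is NOT a hypothesis at genuine data — it is [IUTchIV] Step (iii), a THEOREM of the
     tree at that tower; FACT rows used: none (Mathlib + tree theorems; `#print axioms` standard).
   * `abc_of_descentInputs_exists_genuineVdst` — **p447878's ∃-form E5 spine with `Eq6811` REMOVED from the nine named inputs** in
     exchange for the genuine reading of the two slots (`V^dst_ℚ` ⊆ primes dividing `2·3·5·ℓ` or ramified in `K`; `log(s_ℚ) = Σ log p`)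
     and `[ℚ(j(λ)):ℚ] ≤ [L_mod:ℚ]` (consistent with `d_mod ≤ d` on `U(Q̄)_{≤d}`: `dmod_le_of_mem_UPle`, the tree's `Cor22.dmod_le_degree`):
     EIGHT named inputs + glue ⟹ `ABC`. Implication only; NO abc claim.
3. **Y-21d — the printed shape of Prop. 6.10.9** (`LocusVolumeDatum.prop6109_iff_neg_mul_le_abs`, `prop6109_of_rhs_nonneg`): AS PRINTED
   (absolute-value bars, [J-III] §9.11.1 sign convention) Prop. 6.10.9 at `p` says exactly `−ℓ*·RHS_p ≤ |log Vol(hull(Θ̃^𝓘_p))|` — a LOWER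
   bound on the modulus of the local hull log-volume, automatic when `RHS_p ≥ 0`; its content ([IUTchIV] Step (v), the summand of
   `Thm110Numerics.ProofData.hull_le`) is an INPUT on OUR side too and the slot `logVolAt` has no genuine glue typed — LOCATED, not
   derivable from the FROZEN FACT-LIST (census memo; the kernel lines only fix the reading).
[claim: Joshi2024ATS4, status: disputed]; [claim: Mochizuki2012, status: disputed] for the [IUTchIV] locators.
-/

noncomputable section

namespace Summit.ABC.IUTFork.Joshi.ATS4

open Literature.NumberTheory.DiophantineGeometry Literature.NumberTheory.DiophantineGeometry.GenEll
open Literature.NumberTheory.EllipticCurves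
open Literature.IUT.LogVolume Literature.IUT.LogVolume.Cor22
open NumberField IsDedekindDomain
open scoped Classical

/-! ## 1. Y-21a: the content of `MainBoundGlue` on the carrier side -/

namespace LocusVolumeDatum

/-- **Y-21a (census, kernel): what `MainBoundGlue` imposes on E-t31's carrier.** A `LocusVolumeDatum` is glued to SOME Thm-6.1.1
datum `M : MainBoundDatum` iff its `ℓ` is prime, `η_prm = 60` (Prop. 6.2.1), `e*_mod = 2¹²·3³·5·e_mod` with `1 ≤ e_mod ≤ d_mod`
(§4.1.1 (4)–(5)), `log(d_{L′}) ≥ 0` and `log(q) > 0` («V^{odd,ss} ≠ ∅»). DEFINITIONAL (eight equalities; the unglued slots are free).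
[claim: Joshi2024ATS4, status: disputed] -/
theorem exists_mainBoundGlue_iff (d : LocusVolumeDatum) :
    (∃ M : MainBoundDatum, MainBoundGlue M d) ↔
      d.l.Prime ∧ d.eta = etaPrm ∧ (∃ e : ℕ, 1 ≤ e ∧ e ≤ d.dmod ∧ d.estar = ((2 ^ 12 * 3 ^ 3 * 5 * e : ℕ) : ℝ)) ∧
        0 ≤ d.logDiffLp ∧ 0 < d.logq := by
  constructor
  · rintro ⟨M, G⟩
    refine ⟨?_, G.eta_eq, ⟨M.emod, M.one_le_emod, ?_, ?_⟩, ?_, ?_⟩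
    · rw [G.l_eq]; exact M.ell_prime
    · rw [G.dmod_eq]; exact M.emod_le_dmod
    · rw [G.estar_eq]; rfl
    · rw [G.logDiffLp_eq]; exact M.logDiffLp_nonneg
    · rw [G.logq_eq]; exact M.logq_pos
  · rintro ⟨hl, heta, ⟨e, he1, hed, hest⟩, hDLp, hq⟩
    exact ⟨{
        ell := d.l, ell_prime := hl, five_le_ell := d.five_le_l, dmod := d.dmod, one_le_dmod := d.one_le_dmod,
        emod := e, one_le_emod := he1, emod_le_dmod := hed, logq := d.logq, logq_pos := hq,
        logDiffLtpd := d.logDiffTpd, logDiffLtpd_nonneg := d.logDiffTpd_nonneg,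
        logCondLtpd := d.logCondTpd, logCondLtpd_nonneg := d.logCondTpd_nonneg,
        logDiffL := 0, logDiffL_nonneg := le_rfl, logCondL := 0, logCondL_nonneg := le_rfl,
        logDiffLp := d.logDiffLp, logDiffLp_nonneg := hDLp, logCondLp := 0, logCondLp_nonneg := le_rfl,
        degLLtpd := 1, one_le_degLLtpd := le_rfl, degLpL := 1, one_le_degLpL := le_rfl },
      ⟨rfl, rfl, hest, heta, rfl, rfl, rfl, rfl⟩⟩

end LocusVolumeDatum

/-- **Every Thm-6.1.1 datum has a glued carrier** (copy the eight glued numbers; the free slots take any admissible value — here one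
distinguished prime, all volumes `0`, `|log(q_ℓ)| := 1`). With the NINE inputs added this becomes E-t35's calibration
`MainBoundDatum.exists_glue_inputs_iff` (p446138): glue alone is no constraint on `M`. [claim: Joshi2024ATS4, status: disputed] -/
theorem MainBoundDatum.exists_mainBoundGlue (M : MainBoundDatum) : ∃ dd : LocusVolumeDatum, MainBoundGlue M dd := by
  have hest : (552960 : ℝ) ≤ (M.estar : ℝ) := by
    have h1 : (1 : ℝ) ≤ M.emod := by exact_mod_cast M.one_le_emod
    unfold MainBoundDatum.estar; push_cast; nlinarith
  have heta : (0 : ℝ) ≤ etaPrm := by unfold etaPrm; norm_num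
  exact ⟨{
      l := M.ell, five_le_l := M.five_le_ell, dmod := M.dmod, one_le_dmod := M.one_le_dmod,
      estar := (M.estar : ℝ), estar_ge := hest, eta := etaPrm, eta_nonneg := heta,
      logDiffTpd := M.logDiffLtpd, logDiffTpd_nonneg := M.logDiffLtpd_nonneg,
      logCondTpd := M.logCondLtpd, logCondTpd_nonneg := M.logCondLtpd_nonneg, logDiffLp := M.logDiffLp,
      logq := M.logq, logq_nonneg := M.logq_pos.le, logsQ := 0, logsLe := 0, Vdst := {2},
      logDiffLpAt := fun _ => M.logDiffLp, logqAt := fun _ => M.logq, logsQAt := fun _ => 0, logsLeAt := fun _ => 0,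
      logVolAt := fun _ => 0, logVolArch := 0, logVolHull := 0, logVolHullFrob := 0,
      absLogThetaQ := 1, absLogThetaQ_pos := one_pos, absLogThetaQFrob := 1 },
    ⟨rfl, rfl, rfl, rfl, rfl, rfl, rfl, rfl⟩⟩

/-! ## 2. Y-21f: (6.8.11) at the genuine theta tower `L_tpd ⊆ L ⊆ L′` = `F_tpd ⊆ F ⊆ K` -/

section ThetaTower

variable {P : NFPoint} {F : Type} [Field F] [NumberField F] [Algebra P.F F]
  {K : Type} [Field K] [NumberField K] [Algebra F K] [Algebra P.F K] [IsScalarTower P.F F K]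
  (ψ : K →ₐ[F] AlgebraicClosure F) {ℓ : ℕ}

/-- **Lemma 6.7.1 (2) ⟹ (3) at the genuine tower, in the tree's (D0) ⟹ (D5) shape** (p.61 l.24–30; [IUTchIV] Step (iii) (D0) p.24,
(D5)/(D6) p.25): a finite prime `u` of `K = L′` ramified over `ℚ` whose residue characteristic does not divide `2·3·5·ℓ` lies over a
place of `F_tpd` which is bad away from `{2, ℓ}` (in `Supp(q_{L_tpd})`) or itself ramified over `ℚ` (in `Supp(d_{L_tpd})`). From the
tree's Prop. 1.8 (vi)(vii) instance forms for THIS tower (`Cor22.ramificationIdx_divisionTower_eq_one`: `K/F` unramified at good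
places `∤ ℓ`; `Cor22.ramificationIdx_thetaField_eq_one`: `F/F_tpd` unramified at good places `∤ 30`) through abc-iut-L5-t15's
descent `ramified_place_descends_of_not_dvd`. PROVED (classical). [cite: Mochizuki2012, IUTchIV Thm 1.10 proof Step (iii) p.25] -/
theorem thetaTower_ramified_descends (hU : P.InU) (hF : IsThetaField P F) [IsGalois F K] (hℓ : ℓ.Prime)
    (hK : letI := thetaCurve_isElliptic hU F
      ((thetaCurve P F).galoisRepTorsion (ℓ : ℤ)).ker ≤ ψ.fieldRange.fixingSubgroup)
    (u : HeightOneSpectrum (𝓞 K)) (hram : 2 ≤ u.asIdeal.ramificationIdx ℤ)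
    (hndvd : ¬ residueChar K u ∣ 2 * 3 * 5 * ℓ) :
    finBelow P.F K u ∈ badPlacesAvoid P {2, ℓ} ∨ 2 ≤ (finBelow P.F K u).asIdeal.ramificationIdx ℤ := by
  letI := thetaCurve_isElliptic hU F
  have hfb : ∀ u : HeightOneSpectrum (𝓞 K), finBelow P.F F (finBelow F K u) = finBelow P.F K u :=
    fun u => finBelow_finBelow P.F F K u
  have hS : ∀ p ∈ ({2, ℓ} : Finset ℕ), p.Prime := by
    intro p hp
    simp only [Finset.mem_insert, Finset.mem_singleton] at hp
    rcases hp with rfl | rfl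
    · exact Nat.prime_two
    · exact hℓ
  have avoid_of_bad : ∀ v : HeightOneSpectrum (𝓞 P.F), v ∈ badPlaces P → residueChar P.F v ≠ 2 →
      residueChar P.F v ≠ ℓ → v ∈ badPlacesAvoid P {2, ℓ} := by
    intro v hv h2 hl'
    refine mem_badPlacesAvoid_of_residueChar_notMem hS hv ?_
    simp only [Finset.mem_insert, Finset.mem_singleton, not_or]
    exact ⟨h2, hl'⟩
  -- (D0), layer `K/F`: unramified at good places of residue characteristic `∉ {2,3,5,ℓ}`
  have hKunr : ∀ u : HeightOneSpectrum (𝓞 K), residueChar K u ∉ ({2, 3, 5, ℓ} : Finset ℕ) →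
      finBelow P.F K u ∉ badPlacesAvoid P {2, ℓ} → u.asIdeal.ramificationIdx (𝓞 F) = 1 := by
    intro u hp hSu
    simp only [Finset.mem_insert, Finset.mem_singleton, not_or] at hp
    refine ramificationIdx_divisionTower_eq_one ψ hU hF hK u
      (natCast_notMem_finBelow_of_residueChar_ne hℓ u hp.2.2.2) fun hb => hSu ?_
    rw [hfb u] at hb
    have hres : residueChar P.F (finBelow P.F K u) = residueChar K u := residueChar_finBelow (F := P.F) u
    exact avoid_of_bad _ hb (by rw [hres]; exact hp.1) (by rw [hres]; exact hp.2.2.2)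
  -- (D0), layer `F/F_tpd`: unramified at good places of residue characteristic `∉ {2,3,5,ℓ}`
  have hFunr : ∀ w : HeightOneSpectrum (𝓞 F), residueChar F w ∉ ({2, 3, 5, ℓ} : Finset ℕ) →
      finBelow P.F F w ∉ badPlacesAvoid P {2, ℓ} → w.asIdeal.ramificationIdx (𝓞 P.F) = 1 := by
    intro w hp hSw
    simp only [Finset.mem_insert, Finset.mem_singleton, not_or] at hp
    have h30 : residueChar F w ∉ ({2, 3, 5} : Finset ℕ) := by
      simp only [Finset.mem_insert, Finset.mem_singleton, not_or]; exact ⟨hp.1, hp.2.1, hp.2.2.1⟩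
    refine ramificationIdx_thetaField_eq_one F hU hF w (thirty_notMem_finBelow_of_residueChar_notMem w h30)
      fun hb => hSw ?_
    have hres : residueChar P.F (finBelow P.F F w) = residueChar F w := residueChar_finBelow (F := P.F) w
    exact avoid_of_bad _ hb (by rw [hres]; exact hp.1) (by rw [hres]; exact hp.2.2.2)
  exact ramified_place_descends_of_not_dvd P.F F K (badPlacesAvoid P {2, ℓ}) hKunr hFunr u hram hndvd

/-- **(6.8.11) at the genuine theta tower — [IUTchIV] Step (iii) is a THEOREM there** (p.64 l.2–13 with Lemma 6.7.1 (1)⟺(2) p.61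
l.24–30; [IUTchIV] p.26). For `λ ∈ U_X` minimally presented, `ℓ` prime, `F` a theta field of `λ`, `K ⊇ F` Galois inside `F(E_F[ℓ])`
(via `ψ`), and ANY finite set `V` of primes each of which divides `2·3·5·ℓ` or ramifies in `K` (⊇ Joshi's `V^dst_ℚ` by (1)⟺(2)):
`Σ_{p ∈ V} log p ≤ 2·[ℚ(j(λ)):ℚ]·(log-diff(λ) + log f^{∤{2,ℓ}}(λ)) + log(2·3·5·ℓ)` — `d_mod = [F_mod : ℚ]` with `F_mod = ℚ(j(λ))`
(`Cor22.dmod`), over which `F_tpd` is Galois (`Cor22.isGalois_adjoin_jInv`). abc-iut-L5-t15's `sum_log_distinguished_le_tower` with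
(D0) ⟹ (D5) = `thetaTower_ramified_descends`. PROVED; no hypothesis beyond the binders.
[cite: Mochizuki2012, IUTchIV Thm 1.10 proof Step (iii) p.26] -/
theorem sum_log_vdst_le_thetaTower (hP : P ∈ UP) (hF : IsThetaField P F) [IsGalois F K] (hℓ : ℓ.Prime)
    (hK : letI := thetaCurve_isElliptic hP.1 F
      ((thetaCurve P F).galoisRepTorsion (ℓ : ℤ)).ker ≤ ψ.fieldRange.fixingSubgroup)
    (V : Finset ℕ) (hV : ∀ q ∈ V, q.Prime)
    (hVK : ∀ q ∈ V, q ∣ 2 * 3 * 5 * ℓ ∨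
      ∃ u : HeightOneSpectrum (𝓞 K), residueChar K u = q ∧ 2 ≤ u.asIdeal.ramificationIdx ℤ) :
    ∑ q ∈ V, Real.log q ≤
      2 * (dmod P : ℝ) * (P.logDiff + logCondAvoid P {2, ℓ}) + Real.log (2 * 3 * 5 * (ℓ : ℝ)) := by
  -- the Galois layer `F_mod = ℚ(j(λ)) ⊆ F_tpd`
  set Fmod := IntermediateField.adjoin ℚ ({jInv P.x} : Set P.F) with hFmod
  haveI : NumberField Fmod := NumberField.mk
  haveI : IsGalois Fmod P.F := isGalois_adjoin_jInv P hP
  -- bad places of `F_tpd` away from `{2, ℓ}` and their images in `F_mod`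
  set T₀ := badPlacesAvoid P {2, ℓ} with hT₀
  set S := T₀.image (finBelow Fmod P.F) with hS
  have hT : ∀ w, w ∈ T₀ ↔ finBelow Fmod P.F w ∈ S := by
    intro w
    refine ⟨fun hw => Finset.mem_image_of_mem _ hw, fun hw => ?_⟩
    obtain ⟨w', hw', hww'⟩ := Finset.mem_image.mp hw
    exact mem_badPlacesAvoid_of_finBelow_eq P {2, ℓ} hww'.symm hw'
  -- the right-hand side in the tower lemma's currency
  have hrhs : 2 * (Module.finrank ℚ Fmod : ℝ) *
      (ndeg P.F (differentDivisor P.F) + ndeg P.F (ADivisor.reduced T₀)) + Real.log (2 * 3 * 5 * (ℓ : ℝ)) =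
      2 * (dmod P : ℝ) * (P.logDiff + logCondAvoid P {2, ℓ}) + Real.log (2 * 3 * 5 * (ℓ : ℝ)) := by
    rw [logDiff_add_logCondAvoid_eq_ndeg]
    rfl
  rw [← hrhs]
  exact sum_log_distinguished_le_tower P.F K Fmod S T₀ hT hℓ.pos V hV hVK
    fun u hram hndvd => thetaTower_ramified_descends ψ hP.1 hF hℓ hK u hram hndvd

variable (Lmod : Type*) [Field Lmod] [NumberField Lmod] (h5 : 5 ≤ ℓ)
  (hq : 0 < (TateDivisorDatum.ofNFPointOver P {2, ℓ} F).logq)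

/-- **Y-21f DECIDED-DERIVED: `Eq6811` HOLDS for every carrier glued to the genuine theta datum whose `V^dst_ℚ` / `log(s_ℚ)` slots
are read genuinely.** For `dd` with `MainBoundGlue (MainBoundDatum.ofGenuine L_mod … (ofNFPoint λ {2,ℓ}) (ofNFPointOver λ {2,ℓ} F)
(ofNFPointOver λ {2,ℓ} K)) dd` (p447878's datum), `dd.Vdst` a set of primes each dividing `2·3·5·ℓ` or ramifying in `K = L′` (Lemma
6.7.1 (1)⟺(2)), `dd.logsQ = Σ_{p ∈ dd.Vdst} log p` ((6.8.12)), and a supplier field with `[L_mod : ℚ] ≥ [ℚ(j(λ)) : ℚ]` (equality for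
Joshi's `L_mod` = the field of moduli, §4.1.1 (2); the spine's consumer reads only `d_mod ≤ d`): (6.8.11) `log(s_ℚ) ≤
2·d_mod·(log d_{L_tpd} + log f_{L_tpd}) + log(2·3·5·ℓ)` holds — by `sum_log_vdst_le_thetaTower`, E-t30's dictionary
`thetaTower_logDiffCond_eq` («log d_{L_tpd} + log f_{L_tpd}» = `log-diff(λ) + log f^{∤{2,ℓ}}(λ)`) and the glue. PROVED; FACT rows: none.
[claim: Joshi2024ATS4, status: disputed] -/
theorem LocusVolumeDatum.eq6811_of_thetaTowerGlue (hP : P ∈ UP) (hF : IsThetaField P F) [IsGalois F K] (hℓ : ℓ.Prime)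
    (hK : letI := thetaCurve_isElliptic hP.1 F
      ((thetaCurve P F).galoisRepTorsion (ℓ : ℤ)).ker ≤ ψ.fieldRange.fixingSubgroup)
    {dd : LocusVolumeDatum}
    (G : MainBoundGlue (MainBoundDatum.ofGenuine Lmod hℓ h5 (TateDivisorDatum.ofNFPoint P {2, ℓ})
      (TateDivisorDatum.ofNFPointOver P {2, ℓ} F) (TateDivisorDatum.ofNFPointOver P {2, ℓ} K) hq) dd)
    (hmod : Cor22.dmod P ≤ dMod Lmod) (hV : ∀ q ∈ dd.Vdst, q.Prime)
    (hVK : ∀ q ∈ dd.Vdst, q ∣ 2 * 3 * 5 * ℓ ∨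
      ∃ u : HeightOneSpectrum (𝓞 K), residueChar K u = q ∧ 2 ≤ u.asIdeal.ramificationIdx ℤ)
    (hsQ : dd.logsQ = ∑ q ∈ dd.Vdst, Real.log q) : dd.Eq6811 := by
  unfold LocusVolumeDatum.Eq6811
  have hsum := sum_log_vdst_le_thetaTower ψ hP hF hℓ hK dd.Vdst hV hVK
  have hT : dd.logDiffTpd + dd.logCondTpd = P.logDiff + logCondAvoid P {2, ℓ} := by
    rw [G.logDiffTpd_eq, G.logCondTpd_eq]
    exact MainBoundDatum.thetaTower_logDiffCond_eq Lmod hℓ h5 hq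
  have hTnn : 0 ≤ P.logDiff + logCondAvoid P {2, ℓ} := by
    rw [← hT]; exact add_nonneg dd.logDiffTpd_nonneg dd.logCondTpd_nonneg
  have hdm : (Cor22.dmod P : ℝ) ≤ (dd.dmod : ℝ) := by
    rw [G.dmod_eq]; exact_mod_cast hmod
  have hl : (dd.l : ℝ) = (ℓ : ℝ) := by rw [G.l_eq]; rfl
  rw [hsQ, hT, hl]
  have hmono : 2 * (Cor22.dmod P : ℝ) * (P.logDiff + logCondAvoid P {2, ℓ}) ≤
      2 * (dd.dmod : ℝ) * (P.logDiff + logCondAvoid P {2, ℓ}) :=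
    mul_le_mul_of_nonneg_right (by linarith) hTnn
  linarith

/-- **The same with Joshi's own `L_mod`**: for `L_mod := ℚ(j(λ))` (the field of moduli, realised as the subfield
`ℚ(j(λ)) ⊆ F_tpd`) the degree side condition is an equality, so (6.8.11) holds for every glued carrier with genuine `V^dst_ℚ` /
`log(s_ℚ)` slots outright. PROVED. [claim: Joshi2024ATS4, status: disputed] -/
theorem LocusVolumeDatum.eq6811_of_thetaTowerGlue_fieldOfModuli (hP : P ∈ UP) (hF : IsThetaField P F) [IsGalois F K]
    (hℓ : ℓ.Prime)
    (hK : letI := thetaCurve_isElliptic hP.1 F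
      ((thetaCurve P F).galoisRepTorsion (ℓ : ℤ)).ker ≤ ψ.fieldRange.fixingSubgroup)
    {dd : LocusVolumeDatum}
    (G : letI : NumberField (IntermediateField.adjoin ℚ ({jInv P.x} : Set P.F)) := NumberField.mk
      MainBoundGlue (MainBoundDatum.ofGenuine (IntermediateField.adjoin ℚ ({jInv P.x} : Set P.F)) hℓ h5
        (TateDivisorDatum.ofNFPoint P {2, ℓ}) (TateDivisorDatum.ofNFPointOver P {2, ℓ} F)
        (TateDivisorDatum.ofNFPointOver P {2, ℓ} K) hq) dd)
    (hV : ∀ q ∈ dd.Vdst, q.Prime)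
    (hVK : ∀ q ∈ dd.Vdst, q ∣ 2 * 3 * 5 * ℓ ∨
      ∃ u : HeightOneSpectrum (𝓞 K), residueChar K u = q ∧ 2 ≤ u.asIdeal.ramificationIdx ℤ)
    (hsQ : dd.logsQ = ∑ q ∈ dd.Vdst, Real.log q) : dd.Eq6811 :=
  letI : NumberField (IntermediateField.adjoin ℚ ({jInv P.x} : Set P.F)) := NumberField.mk
  LocusVolumeDatum.eq6811_of_thetaTowerGlue ψ _ h5 hq hP hF hℓ hK G le_rfl hV hVK hsQ

end ThetaTower

/-! ## 2b. The E5 spine (∃-form, p447878) with letter f REMOVED in exchange for the genuine reading of `V^dst_ℚ` / `log(s_ℚ)` -/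

/-- **THE E5 SPINE, CLASSICAL LAYER DISCHARGED, ∃-FORM — WITHOUT (6.8.11).** E-t30's `abc_of_descentInputs_exists` (p447878) asks the
supplier, per admissible `(λ, ℓ)`, for `F`, `K`, `ψ`, `L_mod` with `d_mod ≤ d`, and a glued carrier with the NINE named §6.8–§6.11
inputs. If the supplier reads the two slots `V^dst_ℚ` and `log(s_ℚ)` GENUINELY — `V^dst_ℚ` a set of primes each dividing `2·3·5·ℓ`
or ramifying in its `K = L′` (Lemma 6.7.1 (1)⟺(2)), `log(s_ℚ) = Σ_{p ∈ V^dst_ℚ} log p` ((6.8.12)) — and takes `[L_mod : ℚ] ≥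
[ℚ(j(λ)) : ℚ]` (Joshi's `L_mod` IS the field of moduli), then (6.8.11) is no longer owed: EIGHT named inputs remain ((6.11.1), Prop.
6.10.9 on `V^dst_ℚ`, the component sums, Lemma 6.7.8, the LOWER BOUND = [J-III] Cor. 9.11.1.1 at `φ(y₀)`, the two Frobenius-shift
equalities, «(1/2ℓ) log q = |log q_ℓ|»), and `ABC` follows — `eq6811_of_thetaTowerGlue` into p447878. PROVED AS AN IMPLICATION;
nothing of [J-III] or of the eight remaining inputs is discharged; NO abc claim; no side taken. [claim: Joshi2024ATS4, status: disputed] -/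
theorem abc_of_descentInputs_exists_genuineVdst
    (h : ∀ (d : ℕ), 0 < d → ∀ P ∈ UPle d, ∀ (ℓ : ℕ) (hℓ : ℓ.Prime) (h5 : 5 ≤ ℓ), IsLem587Prime d P ℓ → ITDConditions P ℓ →
      AdmitsCore P →
        ∃ (F : Type) (_ : Field F) (_ : NumberField F) (_ : Algebra P.F F)
          (K : Type) (_ : Field K) (_ : NumberField K) (_ : Algebra F K) (_ : Algebra P.F K) (_ : IsScalarTower P.F F K)
          (_ : IsGalois F K) (ψ : K →ₐ[F] AlgebraicClosure F) (hU : P.InU) (_ : IsThetaField P F)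
          (_ : letI := thetaCurve_isElliptic hU F
            ((thetaCurve P F).galoisRepTorsion (ℓ : ℤ)).ker ≤ ψ.fieldRange.fixingSubgroup)
          (hq : 0 < (TateDivisorDatum.ofNFPointOver P {2, ℓ} F).logq)
          (Lmod : Type) (_ : Field Lmod) (_ : NumberField Lmod) (_ : Cor22.dmod P ≤ dMod Lmod) (dd : LocusVolumeDatum),
          MainBoundGlue (MainBoundDatum.ofGenuine Lmod hℓ h5 (TateDivisorDatum.ofNFPoint P {2, ℓ})
            (TateDivisorDatum.ofNFPointOver P {2, ℓ} F) (TateDivisorDatum.ofNFPointOver P {2, ℓ} K) hq) dd ∧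
          ((∀ q ∈ dd.Vdst, q.Prime ∧ (q ∣ 2 * 3 * 5 * ℓ ∨
              ∃ u : HeightOneSpectrum (𝓞 K), residueChar K u = q ∧ 2 ≤ u.asIdeal.ramificationIdx ℤ)) ∧
            dd.logsQ = ∑ q ∈ dd.Vdst, Real.log q) ∧
          (dd.Eq6111 ∧ (∀ p ∈ dd.Vdst, dd.Prop6109 p) ∧ dd.ComponentSums ∧ dd.Lem678 ∧ dd.LowerBound ∧
            dd.FrobShiftQ ∧ dd.FrobShiftVol ∧ dd.LogqDictionary) ∧
          dMod Lmod ≤ d) : ABC := by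
  refine abc_of_descentInputs_exists fun d hd P hP ℓ hℓ h5 hℓP hITD hcore => ?_
  obtain ⟨F, _, _, _, K, _, _, _, _, _, _, ψ, hU, hF, hK, hq, Lmod, _, _, hmod, dd, G, ⟨hV, hsQ⟩,
    ⟨h₁, h₂, h₃, h₆, h₇, h₈, h₉, hDic⟩, hdmod⟩ := h d hd P hP ℓ hℓ h5 hℓP hITD hcore
  have h₅ : dd.Eq6811 :=
    LocusVolumeDatum.eq6811_of_thetaTowerGlue ψ Lmod h5 hq hP.1 hF hℓ hK G hmod (fun q hq' => (hV q hq').1)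
      (fun q hq' => (hV q hq').2) hsQ
  exact ⟨F, inferInstance, inferInstance, inferInstance, K, inferInstance, inferInstance, inferInstance, inferInstance,
    inferInstance, inferInstance, ψ, hU, hF, hK, hq, Lmod, inferInstance, inferInstance, dd, G,
    ⟨h₁, h₂, h₃, h₅, h₆, h₇, h₈, h₉, hDic⟩, hdmod⟩

/-- The extra side condition `[ℚ(j(λ)):ℚ] ≤ [L_mod:ℚ] ≤ d` of `abc_of_descentInputs_exists_genuineVdst` is CONSISTENT on `U(Q̄)_{≤d}`:
`[ℚ(j(λ)):ℚ] ≤ deg λ ≤ d` (the tree's `Cor22.dmod_le_degree`; Joshi §4.1.2 (8) «L_mod ⊆ L_tpd»), so `L_mod := F_tpd` (or the field of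
moduli itself) serves. PROVED. [claim: Joshi2024ATS4, status: disputed] -/
theorem dmod_le_of_mem_UPle {d : ℕ} {P : NFPoint} (hP : P ∈ UPle d) : Cor22.dmod P ≤ dMod P.F ∧ dMod P.F ≤ d :=
  ⟨Cor22.dmod_le_degree P, hP.2⟩

/-! ## 3. Y-21d: what Prop. 6.10.9 AS PRINTED says about the local hull log-volume -/

namespace LocusVolumeDatum

variable (d : LocusVolumeDatum)

/-- **Prop. 6.10.9 AS PRINTED is a LOWER bound on `|log Vol(hull(Θ̃^𝓘_{Mochizuki,p}))|`** (p.69 l.1–28 with the bars of [J-III]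
§9.11.1): at `p`, `Prop6109 p ⟺ −ℓ*·RHS_p ≤ |logVolAt p|`, `RHS_p = ((ℓ+1)/4)·{(1 + 4/ℓ)·log(d_{L′,p}) − (1/6)·log(q_p) + (4/ℓ)·
log(s_{ℚ,p}) + (20/3)·e*_mod·log(s^≤_p)}` (`ℓ* = (ℓ−1)/2 > 0`). Census reading: the slot is constrained from below in modulus only;
the content ([IUTchIV] Step (v)) is an input on both sides. PROVED (real arithmetic). [claim: Joshi2024ATS4, status: disputed] -/
theorem prop6109_iff_neg_mul_le_abs (p : ℕ) :
    d.Prop6109 p ↔ -(d.lstar * (((d.l : ℝ) + 1) / 4 *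
      ((1 + 4 / (d.l : ℝ)) * d.logDiffLpAt p - 1 / 6 * d.logqAt p + 4 / (d.l : ℝ) * d.logsQAt p
        + 20 / 3 * d.estar * d.logsLeAt p))) ≤ |d.logVolAt p| := by
  have hls : 0 < d.lstar := d.lstar_pos
  have key : ∀ y R : ℝ, -(1 / d.lstar) * y ≤ R ↔ -(d.lstar * R) ≤ y := fun y R => by
    rw [show -(1 / d.lstar) * y = (-y) / d.lstar by ring, div_le_iff₀ hls]
    constructor <;> intro h <;> linarith
  unfold Prop6109
  exact key _ _

/-- When the printed right-hand side at `p` is `≥ 0`, Prop. 6.10.9 AS PRINTED holds at `p` for EVERY value of the local hull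
log-volume slot (`−(1/ℓ*)·|x| ≤ 0 ≤ RHS_p`). PROVED. [claim: Joshi2024ATS4, status: disputed] -/
theorem prop6109_of_rhs_nonneg (p : ℕ)
    (h : 0 ≤ ((d.l : ℝ) + 1) / 4 *
      ((1 + 4 / (d.l : ℝ)) * d.logDiffLpAt p - 1 / 6 * d.logqAt p + 4 / (d.l : ℝ) * d.logsQAt p
        + 20 / 3 * d.estar * d.logsLeAt p)) : d.Prop6109 p := by
  have hls : 0 < d.lstar := d.lstar_pos
  have h1 : -(1 / d.lstar) * |d.logVolAt p| ≤ 0 := by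
    have := abs_nonneg (d.logVolAt p)
    have : 0 ≤ 1 / d.lstar := (one_div_pos.mpr hls).le
    nlinarith
  unfold Prop6109
  linarith

end LocusVolumeDatum

end Summit.ABC.IUTFork.Joshi.ATS4

end
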